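import Summits.CriticalPhenomena.PercolationContinuityZ3.Theorems.PercNearOneGluingNoHeavyLowerTailKnQuestion8CoefficientwiseNoCoreDecoration
import Summits.CriticalPhenomena.PercolationContinuityZ3.Theorems.PercNearOneGluingNoHeavyLowerTailKnQuestion8CoefficientwiseRootEdgeDominationPoint
import HarnessLib

/-!
# Root-edge domination (REM) is decoration-closed: the pocket identity, and p-star deletion monotonicity (PD) inside a target-free pocket — prim-lf-2 gen 68

Support file (`--supports stmt-CriticalPhenomena-4575`, closed), prover `prim-lf-2` (gen 68).  No definitions, no named facts, no sorries; standard axioms.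
Memo `prim-lf-2/CW-SUBROWS-gen68.md` §4.  Template: gen 55's `…CoefficientwiseNoCoreDecoration.lean` (the bilinear NO-CORE class); the LINEAR row needs no Harris term.

Setting (CONJECTURE (REM), prim-lf-2 gen 66, `…CoefficientwiseRootEdgeDomination.lean`; CONJECTURE (PD), gen 67, `…CoefficientwiseRootEdgePStarDeletion.lean`):
finite multigraph `ends : ι → Sym2 V`, edge set `F`, root `x`, root edge `e` (ends `{x,p}`), target set `W`, `C_v(s) = openCluster (ends '' s) v`,
  `REM_F(e; x, W)[g] := Σ_{s ⊆ F : e ∈ s, ∀ w ∈ W ¬(w ∈ C_x s ∧ w ∈ C_x(F∖s))} (g(C_x s) − g(C_x(F∖s)))`.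
A DECORATION (pocket) is an edge set `D` disjoint from `E` whose edges meet `E`-edges only at one vertex `u`, with the root and the targets on `D`-edges only if they equal `u`.
* `Coefficientwise.rem_decoration_eq` — **POCKET IDENTITY**: `REM_{E∪D}(e;x,W)[g] = Σ_{t ⊆ D} REM_E(e;x,W)[g_t]` with the glued monotone functions
  `g_t(X) = g(X ∪ [u ∈ X]·C_u(t))` (clusters glue as `C_x(s ∪ t) = C_x(s) ∪ [u ∈ C_x s]·C_u(t)`, `mem_openCluster_union_glue`; the blue side is re-indexed by `t ↦ D∖t`).
* `Coefficientwise.rem_nonneg_decoration` — hence `REM_E(e;x,W)[·] ≥ 0` for all monotone functions implies `REM_{E∪D}(e;x,W)[·] ≥ 0` for all monotone functions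
  (REM-positivity is closed under hanging target-free multigraphs at any vertex, in particular under cycles through the root `x` — beyond `rem_nonneg_of_rootOffCycles`).
* `Coefficientwise.rem_sub_rem_erase_eq_of_decoration` — for `f ∈ D`: `REM_{E∪D}[g] − REM_{E∪(D.erase f)}[g] = Σ_{t ⊆ D.erase f} REM_E[g_{insert f t}]`; so
  `Coefficientwise.rem_erase_le_of_decoration`: **(PD) holds for every edge of a target-free pocket hung at `p`** (e.g. `f = pq` with `q` pendant) whenever `REM_E[·] ≥ 0`
  for all monotone functions — unconditionally for `|W| ≤ 1` by `rem_nonneg_of_single_target` / `rem_nonneg_of_empty` (`Coefficientwise.rem_erase_le_of_decoration_single`).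
[cite: KozmaNitzan2024, Questions 8–9 (§5.5 p. 36) (context: the Question-8 pocket covariance programme)]
-/

namespace Summit.CriticalPhenomena.PercolationContinuityZ3.Theorems

open Finset Literature.Probability.Percolation

namespace Coefficientwise

variable {ι V : Type*} [DecidableEq ι]

open Classical in
/-- **POCKET IDENTITY for the REM row.**  Let `E, D ⊆ ι` be disjoint edge sets of `ends : ι → Sym2 V` such that an `E`-edge and a `D`-edge can only share the vertex `u`,
the root `x` lies on a `D`-edge only if `x = u`, every target `w ∈ W` lies on a `D`-edge only if `w = u`, and `e ∈ E`.  Then for every `g : Set V → ℝ`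
`REM_{E∪D}(e;x,W)[g] = Σ_{t ⊆ D} REM_E(e;x,W)[X ↦ g(X ∪ {y | u ∈ X ∧ y ∈ C_u(t)})]`.  [cite: KozmaNitzan2024, Questions 8–9 (§5.5 p. 36) (context)] -/
theorem rem_decoration_eq (ends : ι → Sym2 V) {E D : Finset ι} (hED : Disjoint E D) {x u : V} {e : ι} (he : e ∈ E)
    (hsep : ∀ e₁ ∈ E, ∀ e' ∈ D, ∀ w : V, w ∈ ends e₁ → w ∈ ends e' → w = u)
    (hx : ∀ e' ∈ D, x ∈ ends e' → x = u) (W : Set V) (hW : ∀ e' ∈ D, ∀ w ∈ W, w ∈ ends e' → w = u) (g : Set V → ℝ) :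
    ∑ r ∈ (E ∪ D).powerset.filter (fun r : Finset ι => e ∈ r ∧
          ∀ w ∈ W, ¬ (w ∈ openCluster (ends '' (↑r : Set ι)) x ∧ w ∈ openCluster (ends '' (↑((E ∪ D) \ r) : Set ι)) x)),
      (g (openCluster (ends '' (↑r : Set ι)) x) - g (openCluster (ends '' (↑((E ∪ D) \ r) : Set ι)) x)) =
    ∑ t ∈ D.powerset, ∑ s ∈ E.powerset.filter (fun s : Finset ι => e ∈ s ∧
          ∀ w ∈ W, ¬ (w ∈ openCluster (ends '' (↑s : Set ι)) x ∧ w ∈ openCluster (ends '' (↑(E \ s) : Set ι)) x)),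
      (g (openCluster (ends '' (↑s : Set ι)) x ∪ {y | u ∈ openCluster (ends '' (↑s : Set ι)) x ∧ y ∈ openCluster (ends '' (↑t : Set ι)) u}) -
        g (openCluster (ends '' (↑(E \ s) : Set ι)) x ∪ {y | u ∈ openCluster (ends '' (↑(E \ s) : Set ι)) x ∧ y ∈ openCluster (ends '' (↑t : Set ι)) u})) := by
  -- notation: red clusters of `x` and of `u`, and the gluing operation at `u`
  set K : Finset ι → Set V := fun s => openCluster (ends '' (↑s : Set ι)) x with hK
  set R : Finset ι → Set V := fun t => openCluster (ends '' (↑t : Set ι)) u with hR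
  set gl : Set V → Set V → Set V := fun X Y => X ∪ {y | u ∈ X ∧ y ∈ Y} with hgl
  change ∑ r ∈ (E ∪ D).powerset.filter (fun r => e ∈ r ∧ ∀ w ∈ W, ¬ (w ∈ K r ∧ w ∈ K ((E ∪ D) \ r))),
      (g (K r) - g (K ((E ∪ D) \ r))) =
    ∑ t ∈ D.powerset, ∑ s ∈ E.powerset.filter (fun s => e ∈ s ∧ ∀ w ∈ W, ¬ (w ∈ K s ∧ w ∈ K (E \ s))),
      (g (gl (K s) (R t)) - g (gl (K (E \ s)) (R t)))
  have mem_gl : ∀ (X Y : Set V) (y : V), y ∈ gl X Y ↔ y ∈ X ∨ (u ∈ X ∧ y ∈ Y) := fun X Y y => by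
    simp only [hgl, Set.mem_union, Set.mem_setOf_eq]
  -- a target meets the decoration only at `u`, so the no-core event does not see the decoration
  have hwR : ∀ t : Finset ι, t ⊆ D → ∀ w ∈ W, w ∈ R t → w = u := by
    intro t ht w hw hwt
    by_contra hwu
    obtain ⟨e', he', hwe'⟩ := exists_edge_of_mem_openCluster ends hwt hwu
    exact hwu (hW e' (ht he') w hw hwe')
  have w_gl : ∀ (X : Set V) (t : Finset ι), t ⊆ D → ∀ w ∈ W, (w ∈ gl X (R t) ↔ w ∈ X) := by
    intro X t ht w hw
    rw [mem_gl]
    constructor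
    · rintro (h1 | ⟨hu, h2⟩)
      · exact h1
      · rw [hwR t ht w hw h2]; exact hu
    · exact Or.inl
  -- cluster decomposition under gluing at `u`
  have decomp : ∀ s t : Finset ι, s ⊆ E → t ⊆ D → K (s ∪ t) = gl (K s) (R t) := by
    intro s t hs ht
    ext y
    rw [mem_gl]
    exact mem_openCluster_union_glue ends (fun e₁ he₁ e' he' w hw hw' => hsep e₁ (hs he₁) e' (ht he') w hw hw')
      (fun e' he' hxe => hx e' (ht he') hxe) y
  have heD : e ∉ D := fun h => Finset.disjoint_left.mp hED he h
  simp only [Finset.sum_filter]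
  rw [DualBHK.sum_powerset_union hED, Finset.sum_comm]
  -- rewrite each summand through the gluing
  have hsummand : ∀ t ∈ D.powerset, ∀ s ∈ E.powerset,
      (if (e ∈ s ∪ t ∧ ∀ w ∈ W, ¬ (w ∈ K (s ∪ t) ∧ w ∈ K ((E ∪ D) \ (s ∪ t))))
        then (g (K (s ∪ t)) - g (K ((E ∪ D) \ (s ∪ t)))) else 0)
      = (if (e ∈ s ∧ ∀ w ∈ W, ¬ (w ∈ K s ∧ w ∈ K (E \ s))) then (g (gl (K s) (R t)) - g (gl (K (E \ s)) (R (D \ t)))) else 0) := by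
    intro t ht s hs
    have hs' := Finset.mem_powerset.mp hs
    have ht' := Finset.mem_powerset.mp ht
    have hK1 : K (s ∪ t) = gl (K s) (R t) := decomp s t hs' ht'
    have hKc : K ((E ∪ D) \ (s ∪ t)) = gl (K (E \ s)) (R (D \ t)) := by
      rw [union_sdiff_union_of_subset hED hs' ht']
      exact decomp (E \ s) (D \ t) Finset.sdiff_subset Finset.sdiff_subset
    have het : e ∈ s ∪ t ↔ e ∈ s := by
      rw [Finset.mem_union]
      exact ⟨fun h => h.elim id (fun h' => absurd (ht' h') heD), Or.inl⟩
    have hcond : (e ∈ s ∪ t ∧ ∀ w ∈ W, ¬ (w ∈ K (s ∪ t) ∧ w ∈ K ((E ∪ D) \ (s ∪ t)))) ↔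
        (e ∈ s ∧ ∀ w ∈ W, ¬ (w ∈ K s ∧ w ∈ K (E \ s))) := by
      rw [hK1, hKc, het]
      refine and_congr Iff.rfl (forall₂_congr fun w hw => not_congr ?_)
      exact and_congr (w_gl _ _ ht' w hw) (w_gl _ _ Finset.sdiff_subset w hw)
    by_cases hc : (e ∈ s ∪ t ∧ ∀ w ∈ W, ¬ (w ∈ K (s ∪ t) ∧ w ∈ K ((E ∪ D) \ (s ∪ t))))
    · rw [if_pos hc, if_pos (hcond.mp hc), hK1, hKc]
    · rw [if_neg hc, if_neg (fun h => hc (hcond.mpr h))]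
  rw [Finset.sum_congr rfl fun t ht => Finset.sum_congr rfl fun s hs => hsummand t ht s hs]
  simp only [← Finset.sum_filter]
  -- the REM event on `E`
  set S : Finset (Finset ι) := E.powerset.filter (fun s => e ∈ s ∧ ∀ w ∈ W, ¬ (w ∈ K s ∧ w ∈ K (E \ s))) with hS
  change ∑ t ∈ D.powerset, ∑ s ∈ S, (g (gl (K s) (R t)) - g (gl (K (E \ s)) (R (D \ t)))) =
    ∑ t ∈ D.powerset, ∑ s ∈ S, (g (gl (K s) (R t)) - g (gl (K (E \ s)) (R t)))
  -- split into the red part and the blue part, and re-index the blue part by `t ↦ D ∖ t`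
  have hsplitL : ∑ t ∈ D.powerset, ∑ s ∈ S, (g (gl (K s) (R t)) - g (gl (K (E \ s)) (R (D \ t)))) =
      ∑ t ∈ D.powerset, ∑ s ∈ S, g (gl (K s) (R t)) - ∑ t ∈ D.powerset, ∑ s ∈ S, g (gl (K (E \ s)) (R (D \ t))) := by
    rw [← Finset.sum_sub_distrib]
    exact Finset.sum_congr rfl fun t _ => Finset.sum_sub_distrib _ _
  have hsplitR : ∑ t ∈ D.powerset, ∑ s ∈ S, (g (gl (K s) (R t)) - g (gl (K (E \ s)) (R t))) =
      ∑ t ∈ D.powerset, ∑ s ∈ S, g (gl (K s) (R t)) - ∑ t ∈ D.powerset, ∑ s ∈ S, g (gl (K (E \ s)) (R t)) := by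
    rw [← Finset.sum_sub_distrib]
    exact Finset.sum_congr rfl fun t _ => Finset.sum_sub_distrib _ _
  have hflip : ∑ t ∈ D.powerset, ∑ s ∈ S, g (gl (K (E \ s)) (R (D \ t))) = ∑ t ∈ D.powerset, ∑ s ∈ S, g (gl (K (E \ s)) (R t)) :=
    sum_powerset_sdiff D (fun t => ∑ s ∈ S, g (gl (K (E \ s)) (R t)))
  rw [hsplitL, hsplitR, hflip]

open Classical in
/-- **REM-positivity is decoration-closed.**  Under the hypotheses of `rem_decoration_eq`, if `REM_E(e;x,W)[φ] ≥ 0` for every monotone `φ`, then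
`REM_{E∪D}(e;x,W)[g] ≥ 0` for every monotone `g` (an arbitrary target-free multigraph may be hung at any single vertex, also at the root).
[cite: KozmaNitzan2024, Questions 8–9 (§5.5 p. 36) (context)] -/
theorem rem_nonneg_decoration (ends : ι → Sym2 V) {E D : Finset ι} (hED : Disjoint E D) {x u : V} {e : ι} (he : e ∈ E)
    (hsep : ∀ e₁ ∈ E, ∀ e' ∈ D, ∀ w : V, w ∈ ends e₁ → w ∈ ends e' → w = u)
    (hx : ∀ e' ∈ D, x ∈ ends e' → x = u) (W : Set V) (hW : ∀ e' ∈ D, ∀ w ∈ W, w ∈ ends e' → w = u)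
    (h : ∀ φ : Set V → ℝ, Monotone φ →
      0 ≤ ∑ s ∈ E.powerset.filter (fun s : Finset ι => e ∈ s ∧
            ∀ w ∈ W, ¬ (w ∈ openCluster (ends '' (↑s : Set ι)) x ∧ w ∈ openCluster (ends '' (↑(E \ s) : Set ι)) x)),
        (φ (openCluster (ends '' (↑s : Set ι)) x) - φ (openCluster (ends '' (↑(E \ s) : Set ι)) x)))
    (g : Set V → ℝ) (hg : Monotone g) :
    0 ≤ ∑ r ∈ (E ∪ D).powerset.filter (fun r : Finset ι => e ∈ r ∧
          ∀ w ∈ W, ¬ (w ∈ openCluster (ends '' (↑r : Set ι)) x ∧ w ∈ openCluster (ends '' (↑((E ∪ D) \ r) : Set ι)) x)),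
      (g (openCluster (ends '' (↑r : Set ι)) x) - g (openCluster (ends '' (↑((E ∪ D) \ r) : Set ι)) x)) := by
  rw [rem_decoration_eq ends hED he hsep hx W hW g]
  refine Finset.sum_nonneg fun t _ => ?_
  refine h (fun X => g (X ∪ {y | u ∈ X ∧ y ∈ openCluster (ends '' (↑t : Set ι)) u})) ?_
  intro X X' hXX'
  refine hg (Set.union_subset_union hXX' ?_)
  intro y hy
  exact ⟨hXX' hy.1, hy.2⟩

open Classical in
/-- **(PD) inside a pocket — the identity.**  Under the hypotheses of `rem_decoration_eq` and for an edge `f ∈ D` of the decoration,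
`REM_{E∪D}(e;x,W)[g] − REM_{E∪(D.erase f)}(e;x,W)[g] = Σ_{t ⊆ D.erase f} REM_E(e;x,W)[X ↦ g(X ∪ {y | u ∈ X ∧ y ∈ C_u(insert f t)})]`.
[cite: KozmaNitzan2024, Questions 8–9 (§5.5 p. 36) (context)] -/
theorem rem_sub_rem_erase_eq_of_decoration (ends : ι → Sym2 V) {E D : Finset ι} (hED : Disjoint E D) {x u : V} {e : ι} (he : e ∈ E)
    (hsep : ∀ e₁ ∈ E, ∀ e' ∈ D, ∀ w : V, w ∈ ends e₁ → w ∈ ends e' → w = u)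
    (hx : ∀ e' ∈ D, x ∈ ends e' → x = u) (W : Set V) (hW : ∀ e' ∈ D, ∀ w ∈ W, w ∈ ends e' → w = u) (g : Set V → ℝ)
    {f : ι} (hf : f ∈ D) :
    (∑ r ∈ (E ∪ D).powerset.filter (fun r : Finset ι => e ∈ r ∧
          ∀ w ∈ W, ¬ (w ∈ openCluster (ends '' (↑r : Set ι)) x ∧ w ∈ openCluster (ends '' (↑((E ∪ D) \ r) : Set ι)) x)),
      (g (openCluster (ends '' (↑r : Set ι)) x) - g (openCluster (ends '' (↑((E ∪ D) \ r) : Set ι)) x))) -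
    (∑ r ∈ (E ∪ D.erase f).powerset.filter (fun r : Finset ι => e ∈ r ∧
          ∀ w ∈ W, ¬ (w ∈ openCluster (ends '' (↑r : Set ι)) x ∧ w ∈ openCluster (ends '' (↑((E ∪ D.erase f) \ r) : Set ι)) x)),
      (g (openCluster (ends '' (↑r : Set ι)) x) - g (openCluster (ends '' (↑((E ∪ D.erase f) \ r) : Set ι)) x))) =
    ∑ t ∈ (D.erase f).powerset, ∑ s ∈ E.powerset.filter (fun s : Finset ι => e ∈ s ∧
          ∀ w ∈ W, ¬ (w ∈ openCluster (ends '' (↑s : Set ι)) x ∧ w ∈ openCluster (ends '' (↑(E \ s) : Set ι)) x)),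
      (g (openCluster (ends '' (↑s : Set ι)) x ∪ {y | u ∈ openCluster (ends '' (↑s : Set ι)) x ∧ y ∈ openCluster (ends '' (↑(insert f t) : Set ι)) u}) -
        g (openCluster (ends '' (↑(E \ s) : Set ι)) x ∪
          {y | u ∈ openCluster (ends '' (↑(E \ s) : Set ι)) x ∧ y ∈ openCluster (ends '' (↑(insert f t) : Set ι)) u})) := by
  have hED' : Disjoint E (D.erase f) := Finset.disjoint_of_subset_right (Finset.erase_subset f D) hED
  have hsep' : ∀ e₁ ∈ E, ∀ e' ∈ D.erase f, ∀ w : V, w ∈ ends e₁ → w ∈ ends e' → w = u :=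
    fun e₁ he₁ e' he' w hw hw' => hsep e₁ he₁ e' (Finset.mem_of_mem_erase he') w hw hw'
  have hx' : ∀ e' ∈ D.erase f, x ∈ ends e' → x = u := fun e' he' hxe => hx e' (Finset.mem_of_mem_erase he') hxe
  have hW' : ∀ e' ∈ D.erase f, ∀ w ∈ W, w ∈ ends e' → w = u := fun e' he' w hw hwe => hW e' (Finset.mem_of_mem_erase he') w hw hwe
  rw [rem_decoration_eq ends hED he hsep hx W hW g, rem_decoration_eq ends hED' he hsep' hx' W hW' g]
  set D' : Finset ι := D.erase f with hD'
  have hD : D = insert f D' := by rw [hD', Finset.insert_erase hf]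
  have hfD : f ∉ D' := by rw [hD']; exact Finset.notMem_erase f D
  have hpow : D.powerset = (insert f D').powerset := by rw [← hD]
  rw [hpow, Finset.sum_powerset_insert hfD]
  ring

open Classical in
/-- **(PD) for every edge of a target-free pocket at `p` (conditional form).**  Under the hypotheses of `rem_decoration_eq` (decoration `D` hung at `u`; for (PD) take
`u = p`), if `REM_E(e;x,W)[φ] ≥ 0` for every monotone `φ`, then deleting any edge `f ∈ D` does not increase the REM row:
`REM_{E∪(D.erase f)}(e;x,W)[g] ≤ REM_{E∪D}(e;x,W)[g]` for every monotone `g`.  [cite: KozmaNitzan2024, Questions 8–9 (§5.5 p. 36) (context)] -/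
theorem rem_erase_le_of_decoration (ends : ι → Sym2 V) {E D : Finset ι} (hED : Disjoint E D) {x u : V} {e : ι} (he : e ∈ E)
    (hsep : ∀ e₁ ∈ E, ∀ e' ∈ D, ∀ w : V, w ∈ ends e₁ → w ∈ ends e' → w = u)
    (hx : ∀ e' ∈ D, x ∈ ends e' → x = u) (W : Set V) (hW : ∀ e' ∈ D, ∀ w ∈ W, w ∈ ends e' → w = u)
    (h : ∀ φ : Set V → ℝ, Monotone φ →
      0 ≤ ∑ s ∈ E.powerset.filter (fun s : Finset ι => e ∈ s ∧
            ∀ w ∈ W, ¬ (w ∈ openCluster (ends '' (↑s : Set ι)) x ∧ w ∈ openCluster (ends '' (↑(E \ s) : Set ι)) x)),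
        (φ (openCluster (ends '' (↑s : Set ι)) x) - φ (openCluster (ends '' (↑(E \ s) : Set ι)) x)))
    (g : Set V → ℝ) (hg : Monotone g) {f : ι} (hf : f ∈ D) :
    ∑ r ∈ (E ∪ D.erase f).powerset.filter (fun r : Finset ι => e ∈ r ∧
          ∀ w ∈ W, ¬ (w ∈ openCluster (ends '' (↑r : Set ι)) x ∧ w ∈ openCluster (ends '' (↑((E ∪ D.erase f) \ r) : Set ι)) x)),
      (g (openCluster (ends '' (↑r : Set ι)) x) - g (openCluster (ends '' (↑((E ∪ D.erase f) \ r) : Set ι)) x)) ≤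
    ∑ r ∈ (E ∪ D).powerset.filter (fun r : Finset ι => e ∈ r ∧
          ∀ w ∈ W, ¬ (w ∈ openCluster (ends '' (↑r : Set ι)) x ∧ w ∈ openCluster (ends '' (↑((E ∪ D) \ r) : Set ι)) x)),
      (g (openCluster (ends '' (↑r : Set ι)) x) - g (openCluster (ends '' (↑((E ∪ D) \ r) : Set ι)) x)) := by
  rw [← sub_nonneg, rem_sub_rem_erase_eq_of_decoration ends hED he hsep hx W hW g hf]
  refine Finset.sum_nonneg fun t _ => ?_
  refine h (fun X => g (X ∪ {y | u ∈ X ∧ y ∈ openCluster (ends '' (↑(insert f t) : Set ι)) u})) ?_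
  intro X X' hXX'
  refine hg (Set.union_subset_union hXX' ?_)
  intro y hy
  exact ⟨hXX' hy.1, hy.2⟩

open Classical in
/-- **(PD) inside a target-free pocket, at most one target — unconditional.**  Under the hypotheses of `rem_decoration_eq` with `ends e = s(x,p)`, `p ≠ x` and at most one
target (`W ⊆ {y}`, encoded as `∀ w ∈ W, w = y`): for every edge `f ∈ D` and monotone `g`,
`REM_{E∪(D.erase f)}(e;x,W)[g] ≤ REM_{E∪D}(e;x,W)[g]` (by `rem_nonneg_of_single_target` / `rem_nonneg_of_empty` on `E`).
[cite: KozmaNitzan2024, Questions 8–9 (§5.5 p. 36) (context)] -/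
theorem rem_erase_le_of_decoration_single (ends : ι → Sym2 V) {E D : Finset ι} (hED : Disjoint E D) {x u p : V} {e : ι} (he : e ∈ E)
    (hxp : ends e = s(x, p)) (hpx : p ≠ x)
    (hsep : ∀ e₁ ∈ E, ∀ e' ∈ D, ∀ w : V, w ∈ ends e₁ → w ∈ ends e' → w = u)
    (hx : ∀ e' ∈ D, x ∈ ends e' → x = u) (y : V) (W : Set V) (hWy : ∀ w ∈ W, w = y) (hW : ∀ e' ∈ D, ∀ w ∈ W, w ∈ ends e' → w = u)
    (g : Set V → ℝ) (hg : Monotone g) {f : ι} (hf : f ∈ D) :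
    ∑ r ∈ (E ∪ D.erase f).powerset.filter (fun r : Finset ι => e ∈ r ∧
          ∀ w ∈ W, ¬ (w ∈ openCluster (ends '' (↑r : Set ι)) x ∧ w ∈ openCluster (ends '' (↑((E ∪ D.erase f) \ r) : Set ι)) x)),
      (g (openCluster (ends '' (↑r : Set ι)) x) - g (openCluster (ends '' (↑((E ∪ D.erase f) \ r) : Set ι)) x)) ≤
    ∑ r ∈ (E ∪ D).powerset.filter (fun r : Finset ι => e ∈ r ∧
          ∀ w ∈ W, ¬ (w ∈ openCluster (ends '' (↑r : Set ι)) x ∧ w ∈ openCluster (ends '' (↑((E ∪ D) \ r) : Set ι)) x)),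
      (g (openCluster (ends '' (↑r : Set ι)) x) - g (openCluster (ends '' (↑((E ∪ D) \ r) : Set ι)) x)) := by
  refine rem_erase_le_of_decoration ends hED he hsep hx W hW ?_ g hg hf
  intro φ hφ
  -- the REM row of `E` with at most one target is nonnegative
  by_cases hWne : ∃ w, w ∈ W
  · obtain ⟨w₀, hw₀⟩ := hWne
    have hWeq : W = {y} := by
      ext w
      constructor
      · intro hw; exact hWy w hw
      · intro hw
        rw [Set.mem_singleton_iff] at hw
        rw [hw, ← hWy w₀ hw₀]; exact hw₀
    rw [hWeq]
    exact rem_nonneg_of_single_target ends E he hxp hpx y φ hφ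
  · have hWe : W = ∅ := Set.eq_empty_iff_forall_notMem.mpr fun w hw => hWne ⟨w, hw⟩
    rw [hWe]
    exact rem_nonneg_of_empty ends E he hxp hpx φ hφ

end Coefficientwise

end Summit.CriticalPhenomena.PercolationContinuityZ3.Theorems
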